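import Mathlib
import Literature.MathematicalPhysics.QuantumLattice.WilsonDiracAP
import Summits.QuantumFields.QCD.Theorems.QuarksAsStableActionCriticalLineDiamagnetismStubTilingCombinatorics
import Summits.QuantumFields.QCD.Theorems.WilsonQuarkChessboardFlatCellOptimalStubTilingCellDataAllN

/-!
# Combinatorics of the reflection tiling read on the `2⁴` block, `N` colours
(helper for crux stmt-QuantumFields-9307 `FlatCellOptimal`, line `registered`, stub
`stub_localNormGain_of` (G4 transport), sub-goal `stub_tilingCombinatoricsAllN` — the `Fin 3 ↦ Fin N`
port of the sibling crux stmt-QuantumFields-9734's `…CriticalLineDiamagnetismStubTilingCombinatorics`,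
wave 11)

What.  On the even torus `(ℤ/2M)⁴` let `tile_c V` be the period-2 reflection tiling of the `U(N)`
gauge field `V` (ANY `N : ℕ`) about the corner `c`, and let `W_c : Edge 4 2 → U(N)` be the tiling read
at the sixteen representatives `c + a`, `a ∈ (ℤ/2)⁴` (lifted into `ℤ/2M` by `val`).  We prove
(`stub_tilingCombinatoricsAllN`):
(i) `W_c (x + μ̂, μ) = W_c (x, μ)⁻¹` for every block link;
(ii) the `96` plaquette deficits `N - Re tr` of `W_c` on the `2⁴`-torus sum to `4` times the total
deficit of the `24` CELL plaquettes of `V` at `c` (base point `y` with `y_i = c_i`, `y_j = c_j` in the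
plane `(i, j)` and transverse coordinates in `{c_ν, c_ν + 1}`).
The statement is the sibling's `stub_tilingCombinatorics` with `Fin 3 ↦ Fin N`, `3 - Re tr ↦ N - Re tr`,
and with the two `let`s (`tile`, `Wc`) turned into universally quantified variables with their
defining equations (no `:=` in the registered signature).

How (the sibling's proof, `3 ↦ N`).  Everything is phrased for a block field `W` in NORMAL FORM
(`…TilingData.TilingCellData.link_eq` / `cellField_eq`): `W (a, μ) = V (c + a, μ)` if `a_μ = 0` and
`W (a, μ) = V (c + (a + e_μ), μ)⁻¹` if `a_μ = 1`.  (i) is a two-case check (`a + e_μ + e_μ = a` in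
`(ℤ/2)⁴`; `link_shift`, any group).  For (ii), (i) alone implies the REFLECTION IDENTITIES
`hol W (a + î; i, j) = W(a,i)⁻¹ · (hol W (a; i, j))⁻¹ · W(a,i)` and the analogue for `ĵ` (the sibling's
group-generic `holonomy_shift_fst/snd`, re-exported), so the plaquette deficit is invariant under the
two in-plane shifts of the base point (`Re tr` is invariant under conjugation and under inversion on
`U(N)`, `trace_re_conj_inv`); halving the sum twice along these involutions gives
`Σ_{96} = 4 · Σ_{a_i = a_j = 0}` (the sibling's `N`-free `sum_eq_four_mul_sum_filter`, re-exported).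
For `a_i = a_j = 0` the block holonomy IS the cell holonomy `hol V (c + a; i, j)` (`holonomy_base`, any
group), and `(a; i, j) ↦ (c + a; i, j)` is a bijection from `{a_i = a_j = 0}` onto the cell plaquettes
(the sibling's `N`-free `sum_filter_eq_sum_cell`, re-exported; the cell Finset enters only through a
membership characterisation).  The `N`-free lemmas of the sibling file (`sum_eq_two_mul_sum_ite`,
`shift_shift_self`, `shift_shift_comm`, `holonomy_shift_fst`, `holonomy_shift_snd`,
`sum_eq_four_mul_sum_filter`, `rep_cases`, `rep_shift`, `sum_filter_eq_sum_cell`) are imported and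
re-EXPORTED into `…TilingData.TilingCombinatorics` (aliases, no restatement).
Sources: folklore lattice bookkeeping.  Pure theorem file (no `def`s).
-/

noncomputable section

open scoped BigOperators Classical Matrix ComplexConjugate
open Finset
open Literature.MathematicalPhysics.QuantumLattice Literature.MathematicalPhysics.QuantumFieldTheory
  Literature.Probability.LatticeModels

namespace Summit.QuantumFields.QCD.Cruxes.FlatCellOptimal.TilingData

namespace TilingCombinatorics

/-! ### `N`-free lemmas of the sibling file, re-exported (aliases) -/

export Summit.QuantumFields.QCD.Cruxes.CriticalLineDiamagnetism.ChessboardCellGain.TilingCombinatorics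
  (sum_eq_two_mul_sum_ite shift_shift_self shift_shift_comm holonomy_shift_fst holonomy_shift_snd
    sum_eq_four_mul_sum_filter rep_cases rep_shift sum_filter_eq_sum_cell)

variable {N : ℕ}

/-! ### Deficits of a link-odd block field are shift invariant (`U(N)`) -/

/-- `Re tr (u⁻¹ h⁻¹ u) = Re tr h` on `U(N)` (cyclicity of the trace and `Re tr h⁻¹ = Re tr h`). -/
theorem trace_re_conj_inv (u h : Matrix.unitaryGroup (Fin N) ℂ) :
    (((u⁻¹ * h⁻¹ * u : Matrix.unitaryGroup (Fin N) ℂ) : Matrix (Fin N) (Fin N) ℂ)).trace.re =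
      ((h : Matrix (Fin N) (Fin N) ℂ)).trace.re := by
  -- adapted from `TilingCombinatorics.trace_re_conj_inv` (stmt-QuantumFields-9734; `3 ↦ N`, textual)
  rw [mul_assoc, Matrix.UnitaryGroup.mul_val, Matrix.trace_mul_comm, ← Matrix.UnitaryGroup.mul_val,
    mul_inv_cancel_right]
  exact TilingCellData.trace_re_inv h

variable {W : GaugeConfig 4 2 (Matrix.unitaryGroup (Fin N) ℂ)}

/-- The plaquette deficit of a block field with `W (x + μ̂, μ) = W (x, μ)⁻¹` is invariant under the
shift of the base point along the first axis of the plane (`U(N)`). -/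
theorem deficit_shift_fst (hW : ∀ (x : Site 4 2) (μ : Fin 4), W (Site.shift x μ, μ) = (W (x, μ))⁻¹)
    (a : Site 4 2) (i j : Fin 4) :
    (N : ℝ) - (unitaryFundamentalRep (Fin N) ℂ (plaquetteHolonomy W (Site.shift a i) i j)).trace.re =
      (N : ℝ) - (unitaryFundamentalRep (Fin N) ℂ (plaquetteHolonomy W a i j)).trace.re := by
  -- adapted from `TilingCombinatorics.deficit_shift_fst` (stmt-QuantumFields-9734; `3 ↦ N`)
  simp only [unitaryFundamentalRep_apply]
  rw [holonomy_shift_fst hW, trace_re_conj_inv]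

/-- The plaquette deficit of a block field with `W (x + μ̂, μ) = W (x, μ)⁻¹` is invariant under the
shift of the base point along the second axis of the plane (`U(N)`). -/
theorem deficit_shift_snd (hW : ∀ (x : Site 4 2) (μ : Fin 4), W (Site.shift x μ, μ) = (W (x, μ))⁻¹)
    (a : Site 4 2) (i j : Fin 4) :
    (N : ℝ) - (unitaryFundamentalRep (Fin N) ℂ (plaquetteHolonomy W (Site.shift a j) i j)).trace.re =
      (N : ℝ) - (unitaryFundamentalRep (Fin N) ℂ (plaquetteHolonomy W a i j)).trace.re := by
  -- adapted from `TilingCombinatorics.deficit_shift_snd` (stmt-QuantumFields-9734; `3 ↦ N`)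
  simp only [unitaryFundamentalRep_apply]
  rw [holonomy_shift_snd hW, trace_re_conj_inv]

/-! ### The block field in normal form (any group) -/

section NormalForm

variable {G : Type*} [Group G] {M : ℕ} (V : GaugeConfig 4 (2 * M) G) (c : Site 4 (2 * M))
  {X : GaugeConfig 4 2 G}

/-- **Part (i).**  A block field in normal form satisfies `X (x + μ̂, μ) = X (x, μ)⁻¹` (any group). -/
theorem link_shift
    (hX : ∀ (a : Fin 4 → ZMod 2) (μ : Fin 4), X (a, μ) =
      if a μ = 0 then V (fun ν => c ν + (((a ν).val : ℕ) : ZMod (2 * M)), μ)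
      else (V (fun ν => c ν +
        ((((a + Pi.single μ 1 : Fin 4 → ZMod 2) ν).val : ℕ) : ZMod (2 * M)), μ))⁻¹)
    (x : TorusSite 4 2) (μ : Fin 4) : X (Site.shift x μ, μ) = (X (x, μ))⁻¹ := by
  -- adapted from `TilingCombinatorics.link_shift` (stmt-QuantumFields-9734; `U(3) ↦` any group)
  rw [hX, hX x μ, GaugeOrbit.shift_apply_self]
  by_cases h : x μ = 0
  · rw [if_neg (by rw [h]; decide), if_pos h,
      show (Site.shift x μ + Pi.single μ 1 : Fin 4 → ZMod 2) = x from shift_shift_self x μ]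
  · rw [if_pos ((by decide : ∀ z : ZMod 2, ¬z = 0 → z + 1 = 0) _ h), if_neg h, inv_inv]
    rfl

/-- **Base case of part (ii).**  For `a_i = a_j = 0` (`i ≠ j`) the block holonomy at `a` in the plane
`(i, j)` is the cell holonomy of `V` at `c + a` (any group). -/
theorem holonomy_base
    (hX : ∀ (a : Fin 4 → ZMod 2) (μ : Fin 4), X (a, μ) =
      if a μ = 0 then V (fun ν => c ν + (((a ν).val : ℕ) : ZMod (2 * M)), μ)
      else (V (fun ν => c ν +
        ((((a + Pi.single μ 1 : Fin 4 → ZMod 2) ν).val : ℕ) : ZMod (2 * M)), μ))⁻¹)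
    {a : Fin 4 → ZMod 2} {i j : Fin 4} (hij : i ≠ j) (hi : a i = 0) (hj : a j = 0) :
    plaquetteHolonomy X a i j =
      plaquetteHolonomy V (fun ν => c ν + (((a ν).val : ℕ) : ZMod (2 * M))) i j := by
  -- adapted from `TilingCombinatorics.holonomy_base` (stmt-QuantumFields-9734; `U(3) ↦` any group)
  have hsi : Site.shift a i j = 0 := by rw [GaugeOrbit.shift_apply_of_ne a hij.symm, hj]
  have hsj : Site.shift a j i = 0 := by rw [GaugeOrbit.shift_apply_of_ne a hij, hi]
  unfold plaquetteHolonomy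
  rw [hX a i, if_pos hi, hX (Site.shift a i) j, if_pos hsi, hX (Site.shift a j) i, if_pos hsj, hX a j,
    if_pos hj, rep_shift c hi, rep_shift c hj]

end NormalForm

/-! ### Part (ii): the block sum is four times the cell sum -/

variable {M : ℕ} [NeZero M] (V : GaugeConfig 4 (2 * M) (Matrix.unitaryGroup (Fin N) ℂ))
  (c : Site 4 (2 * M))

/-- **Part (ii).**  For a `U(N)` block field in normal form, the `96` block plaquette deficits sum to
four times the total deficit of the cell plaquettes of `V` at `c`. -/
theorem sum_deficit_eq
    (hW : ∀ (a : Fin 4 → ZMod 2) (μ : Fin 4), W (a, μ) =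
      if a μ = 0 then V (fun ν => c ν + (((a ν).val : ℕ) : ZMod (2 * M)), μ)
      else (V (fun ν => c ν +
        ((((a + Pi.single μ 1 : Fin 4 → ZMod 2) ν).val : ℕ) : ZMod (2 * M)), μ))⁻¹)
    {S : Finset (Plaquette 4 (2 * M))}
    (hS : ∀ q : Plaquette 4 (2 * M), q ∈ S ↔ (q.1 q.2.1.1 = c q.2.1.1 ∧ q.1 q.2.1.2 = c q.2.1.2 ∧
      ∀ ν, ν ≠ q.2.1.1 → ν ≠ q.2.1.2 → (q.1 ν = c ν ∨ q.1 ν = c ν + 1))) :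
    ∑ p : Plaquette 4 2,
        ((N : ℝ) - (unitaryFundamentalRep (Fin N) ℂ (plaquetteHolonomy W p.1 p.2.1.1 p.2.1.2)).trace.re) =
      4 * ∑ q ∈ S, ((N : ℝ) - (unitaryFundamentalRep (Fin N) ℂ (plaquetteHolonomy V q.1 q.2.1.1 q.2.1.2)).trace.re) := by
  -- adapted from `TilingCombinatorics.sum_deficit_eq` (stmt-QuantumFields-9734; `3 ↦ N`)
  have hW1 : ∀ (x : Site 4 2) (μ : Fin 4), W (Site.shift x μ, μ) = (W (x, μ))⁻¹ := link_shift V c hW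
  calc ∑ p : Plaquette 4 2,
        ((N : ℝ) - (unitaryFundamentalRep (Fin N) ℂ (plaquetteHolonomy W p.1 p.2.1.1 p.2.1.2)).trace.re)
      = 4 * ∑ p ∈ univ.filter (fun p : Plaquette 4 2 => p.1 p.2.1.1 = 0 ∧ p.1 p.2.1.2 = 0),
          ((N : ℝ) - (unitaryFundamentalRep (Fin N) ℂ (plaquetteHolonomy W p.1 p.2.1.1 p.2.1.2)).trace.re) :=
        sum_eq_four_mul_sum_filter _ (fun p => deficit_shift_fst hW1 p.1 p.2.1.1 p.2.1.2)
          fun p => deficit_shift_snd hW1 p.1 p.2.1.1 p.2.1.2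
    _ = 4 * ∑ p ∈ univ.filter (fun p : Plaquette 4 2 => p.1 p.2.1.1 = 0 ∧ p.1 p.2.1.2 = 0),
          ((N : ℝ) - (unitaryFundamentalRep (Fin N) ℂ (plaquetteHolonomy V
            (fun ν => c ν + (((p.1 ν).val : ℕ) : ZMod (2 * M))) p.2.1.1 p.2.1.2)).trace.re) := by
        congr 1
        refine Finset.sum_congr rfl fun p hp => ?_
        obtain ⟨h₁, h₂⟩ := (Finset.mem_filter.1 hp).2
        rw [holonomy_base V c hW (ne_of_lt p.2.2) h₁ h₂]
    _ = 4 * ∑ q ∈ S,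
          ((N : ℝ) - (unitaryFundamentalRep (Fin N) ℂ (plaquetteHolonomy V q.1 q.2.1.1 q.2.1.2)).trace.re) :=
        congrArg (fun t : ℝ => 4 * t) (sum_filter_eq_sum_cell c (fun q : Plaquette 4 (2 * M) =>
          (N : ℝ) - (unitaryFundamentalRep (Fin N) ℂ (plaquetteHolonomy V q.1 q.2.1.1 q.2.1.2)).trace.re) hS)

end TilingCombinatorics

/-- **Sub-goal `stub_tilingCombinatoricsAllN` (G4 port, wave 11) — the reflection tiling read on the
`2⁴` block, `N` colours.**  For `tile` given by the items' defining equation and the cell field `Wc` of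
the period-2 reflection tiling `tile c V` read at the representatives `c + a`, `a ∈ (ℤ/2)⁴`, on the
even torus `(ℤ/2M)⁴`: (i) `Wc (x + μ̂, μ) = Wc (x, μ)⁻¹`; (ii) the `96` plaquette deficits
`N - Re tr` of `Wc` on the `2⁴`-torus sum to `4` times the total deficit of the cell plaquettes of `V`
at `c` (`TilingCombinatorics.link_shift`, `TilingCombinatorics.sum_deficit_eq`, from the normal form
`TilingCellData.cellField_eq`). -/
theorem stub_tilingCombinatoricsAllN : ∀ (N M : ℕ) [NeZero M] (tile : Site 4 (2 * M) → GaugeConfig 4 (2 * M) (Matrix.unitaryGroup (Fin N) ℂ) → GaugeConfig 4 (2 * M) (Matrix.unitaryGroup (Fin N) ℂ)), (∀ (c : Site 4 (2 * M)) (V : GaugeConfig 4 (2 * M) (Matrix.unitaryGroup (Fin N) ℂ)) (e : Edge 4 (2 * M)), tile c V e = if (e.1 e.2 - c e.2).val % 2 = 0 then V (fun ν => c ν + (((e.1 ν - c ν).val % 2 : ℕ) : ZMod (2 * M)), e.2) else (V (fun ν => c ν + (((Site.shift e.1 e.2 ν - c ν).val % 2 : ℕ) : ZMod (2 * M)), e.2))⁻¹)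 → ∀ (V : GaugeConfig 4 (2 * M) (Matrix.unitaryGroup (Fin N) ℂ)) (c : Site 4 (2 * M)) (Wc : GaugeConfig 4 2 (Matrix.unitaryGroup (Fin N) ℂ)), (∀ e : Edge 4 2, Wc e = tile c V (fun ν => c ν + (((e.1 ν).val : ℕ) : ZMod (2 * M)), e.2)) → (∀ (x : TorusSite 4 2) (μ : Fin 4), Wc (Site.shift x μ, μ) = (Wc (x, μ))⁻¹) ∧ ∑ p : Plaquette 4 2, ((N : ℝ) - (unitaryFundamentalRep (Fin N) ℂ (plaquetteHolonomy Wc p.1 p.2.1.1 p.2.1.2)).trace.re) = 4 * ∑ p ∈ Finset.univ.filter (fun p : Plaquette 4 (2 * M) => p.1 p.2.1.1 = c p.2.1.1 ∧ p.1 p.2.1.2 = c p.2.1.2 ∧ ∀ ν, ν ≠ p.2.1.1 → ν ≠ p.2.1.2 → (p.1 ν = c ν ∨ p.1 ν = c ν + 1)), ((N : ℝ) - (unitaryFundamentalRep (Fin N) ℂ (plaquetteHolonomy V p.1 p.2.1.1 p.2.1.2)).trace.re) := by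
  intro N M _ tile htile V c Wc hWc
  have hW := TilingCellData.cellField_eq V c htile hWc
  exact ⟨TilingCombinatorics.link_shift V c hW, TilingCombinatorics.sum_deficit_eq V c hW fun q => by
    simp only [Finset.mem_filter, Finset.mem_univ, true_and]⟩

end Summit.QuantumFields.QCD.Cruxes.FlatCellOptimal.TilingData

end
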